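import Mathlib.CategoryTheory.Limits.Constructions.FiniteProductsOfBinaryProducts
import Literature.AlgebraicGeometry.Motives.Varieties
import Literature.AlgebraicGeometry.Motives.SegreEmbedding
import Literature.AlgebraicGeometry.Motives.CurveNet
import HarnessLib

/-!
# Self fibre powers of smooth projective varieties are smooth projective

If `X` is a smooth projective `k`-variety of dimension `n` and `Y` is a `(m+1)`-fold self fibre
power of `X` over `k` — i.e. `Y` is the point of a LIMIT fan `Fan.mk Y π` on the constant family
`fun _ : Fin (m + 1) => X` in `SchemeOver k = Over (Spec k)` — then `Y` is smooth projective of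
dimension `n * (m + 1)`.

This is the typing lemma («FibrePowerSmooth») asked for by the pre-birth tribunal of the route
`Summits/HodgeConjecture/HodgeConjecture/Theses/SignSymmetricPowers.lean` (T1 typing note, J
feedback (2)): the crux `PowersHodgeOfSignCommutators` and the leaf `SignThreefoldPowersHodge`
conclude `HodgeConjectureFor (3 * (k + 1)) Y` for a Fan-limit power `Y` without an
`IsSmoothProjective (3 * (k + 1)) Y` hypothesis; its `HodgeModel` conjunct needs exactly this.

Proof: induction on `m`. For `m = 0` the one-legged fan `Fan.mk X (fun _ => 𝟙 X)` is a limit.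
For `m + 1`, Mathlib's `extendFan` / `extendFanIsLimit` builds a limit fan for `m + 2` copies out
of a limit fan `c` for `m + 1` copies and the binary-product fan of `X ⊗ c.pt` (the cartesian
monoidal structure of `Over (Spec k)`, `CartesianMonoidalCategory.tensorProductIsBinaryProduct`);
its point `X ⊗ c.pt` is smooth projective of dimension `n + n * (m + 1)` by
`IsSmoothProjective.tensor_holds` (Segre, PROVED in `Motives/SegreEmbedding.lean`). Any other
limit fan has an isomorphic point (`IsLimit.conePointUniqueUpToIso`) and `IsSmoothProjective` is
isomorphism-invariant (`IsSmoothProjective.of_iso`, `Motives/CurveNet.lean`).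

References: Hartshorne, *Algebraic Geometry*, II Ex. 5.11 (Segre), III Prop. 10.1 (smoothness
under base change and composition). [cite: Hartshorne1977, III Prop. 10.1 and II Ex. 5.11]
-/

noncomputable section

universe u

open CategoryTheory CategoryTheory.Limits MonoidalCategory

namespace Literature.AlgebraicGeometry.Motives

variable {k : Type u} [Field k]

/-- For every `m` there is SOME limit fan on `m + 1` copies of a smooth projective `n`-dimensional
`X` whose point is smooth projective of dimension `n * (m + 1)` (iterated binary fibre products,
Segre). [cite: Hartshorne1977, III Prop. 10.1 and II Ex. 5.11] -/
theorem exists_fan_isLimit_isSmoothProjective {n : ℕ} {X : SchemeOver k}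
    (hX : IsSmoothProjective n X) (m : ℕ) :
    ∃ c : Fan fun _ : Fin (m + 1) => X, Nonempty (IsLimit c) ∧
      IsSmoothProjective (n * (m + 1)) c.pt := by
  induction m with
  | zero =>
    refine ⟨Fan.mk X fun _ => 𝟙 X, ⟨Fan.IsLimit.mk _ (fun s => s.proj 0) ?_ ?_⟩, by simpa using hX⟩
    · intro s j
      obtain ⟨j, hj⟩ := j
      obtain rfl : j = 0 := by omega
      show s.proj 0 ≫ 𝟙 X = s.proj 0
      exact Category.comp_id _
    · intro s f h
      have h0 : f ≫ 𝟙 X = s.proj 0 := h 0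
      rw [← h0]
      exact (Category.comp_id _).symm
  | succ m ih =>
    obtain ⟨c, ⟨hc⟩, hsp⟩ := ih
    refine ⟨extendFan c (BinaryFan.mk (CartesianMonoidalCategory.fst X c.pt)
        (CartesianMonoidalCategory.snd X c.pt)),
      ⟨extendFanIsLimit _ hc (CartesianMonoidalCategory.tensorProductIsBinaryProduct X c.pt)⟩, ?_⟩
    have h : IsSmoothProjective (n + n * (m + 1)) (X ⊗ c.pt) := IsSmoothProjective.tensor_holds hX hsp
    change IsSmoothProjective (n * (m + 1 + 1)) (X ⊗ c.pt)
    convert h using 2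
    ring

/-- **Self fibre powers of smooth projective varieties are smooth projective.** If `X` is smooth
projective of dimension `n` over a field `k` and `Fan.mk Y π` is a limit fan on `m + 1` copies of
`X` (so `Y ≅ X ×ₖ ⋯ ×ₖ X`, `m + 1` factors), then `Y` is smooth projective of dimension
`n * (m + 1)`. [cite: Hartshorne1977, III Prop. 10.1 and II Ex. 5.11] -/
theorem isSmoothProjective_of_isLimit_fan {n m : ℕ} {X Y : SchemeOver k}
    (hX : IsSmoothProjective n X) (π : Fin (m + 1) → (Y ⟶ X)) (hY : IsLimit (Fan.mk Y π)) :
    IsSmoothProjective (n * (m + 1)) Y := by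
  obtain ⟨c, ⟨hc⟩, hsp⟩ := exists_fan_isLimit_isSmoothProjective hX m
  exact IsSmoothProjective.of_iso (hc.conePointUniqueUpToIso hY) hsp

/-- The `∃ π, Nonempty (IsLimit (Fan.mk Y π))` spelling used by the route items
`SignSymmetricPowers.PowersHodgeOfSignCommutators` / `SignThreefoldPowersHodge` (same statement as
`isSmoothProjective_of_isLimit_fan`). [cite: Hartshorne1977, III Prop. 10.1 and II Ex. 5.11] -/
theorem isSmoothProjective_of_exists_isLimit_fan {n m : ℕ} {X Y : SchemeOver k}
    (hX : IsSmoothProjective n X)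
    (hY : ∃ π : Fin (m + 1) → (Y ⟶ X), Nonempty (IsLimit (Fan.mk Y π))) :
    IsSmoothProjective (n * (m + 1)) Y := by
  obtain ⟨π, ⟨h⟩⟩ := hY
  exact isSmoothProjective_of_isLimit_fan hX π h

end Literature.AlgebraicGeometry.Motives

end
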